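import Summits.AtomisticToContinuum.FouriersLaw.Theorems.BondHeatUncertaintyExtensiveSnapshotIrreversibilityEnergyWindowSkeletonGramLimit
import Summits.AtomisticToContinuum.FouriersLaw.Theorems.BondHeatUncertaintyExtensiveSnapshotIrreversibilityEnergyWindowEnergyBudget
import HarnessLib

/-!
# Bond heat uncertainty — energy window: the energy-budget floor beneath (MC∞)

Cell `decomp-a2c`, lens-1 «grading / quantitative ladder», generation 84, crux
`stmt-AtomisticToContinuum-9121` (`ExtensiveSnapshotIrreversibility`, K_fix half, leaf S3), part I-B
Critic rows 1182 (4) (g3) and 1188: the binder of record beneath (MD₂)/(SW⁰₂) is **(MC∞)**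
`SkeletonGramLimitInverseMoments` (part `…EnergyWindowSkeletonGramLimit`): all inverse moments
of the limit Gram floor `L(s, z, wp) = sup_m λ_min(Γ_m)⁺` with `e^{εH(z)}` growth.  This file
SPLITS the anharmonic discharge of (MC∞) into a measure-free half and a measure half, the
measure half (EBM) being the theorem `energyBudgetMoment` of part I-A (`…EnergyBudget`):

  (MC∞) ⟸ (EBF) `EnergyBudgetGramFloor` ∧ (EBM) `EnergyBudgetMoment` — glue PROVED (§1),
  (EBM) PROVED (part I-A), (EBF) decided for the harmonic chain (§2).

* **(EBF)** (NEW leaf, measure-free): `L(s, z, wp) ≥ c_θ · Θ_θ(z, wp)^{-μ}` for SOME `μ > 0`,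
  EVERY `θ > 0` and ALL paths, `s ∈ [½, 1]`, `|δ| < δ₀`, where
  `Θ_θ = ∫₀¹ e^{θH(Φ_u)} du ≥ 1` is the exponential energy budget of part I-A — a sure
  (pathwise) observability floor.  Intended proof («triangular Hörmander is interpolation»):
  the costate `c = (α, β)` of the chain (`β̇ = -α + γ1_B β`, `α̇ = Hess Φ(q_r) β`, tree
  `coDrift`) has `β ∈ C³` pathwise, and the tridiagonal site recursion
  `β_{i+1} V''(q_{i+1} - q_i) = β_i'' - γ b_i β_i' + (Hess Φ)_{ii} β_i + (Hess Φ)_{i,i-1} β_{i-1}`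
  (`V'' ≥ 1`) with Landau–Kolmogorov interpolation on `[0, s]` transfers smallness of
  `‖β_0‖_{L²(0,s)}` (the left-bath Malliavin form) site by site to `|c(s)| = |a|`, all
  constants polynomial in `Θ_θ`; no Brownian roughness, no Norris lemma, no Wiener-polynomial
  machinery (contrast HM2011 §6, Norris 1986).
* **Glue** (PROVED, §1): given `q, ε`, take `r = max(μq, 1)`, `θ₁ = min(εq, 1/(4T))` and the
  floor at `θ = θ₁/r`: `E L^{-q} ≤ c^{-q} E Θ_θ^{μq} ≤ c^{-q} E Θ_{θ₁} ≤ (c⁻¹ e^{2γTθ₁/q} e^{εH})^q`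
  (power means, part I-A; then (EBM) at `θ₁ < 1/max(T ± δ/2)`).
Why (EBF) is NOT a costume of (MC∞): it is measure-free (a statement about every single path),
reaches (MC∞) only through the proved moment bound (EBM), and is stronger in logic (a sure
floor versus integrability of `L^{-q}`); why it might fail: the site-by-site exponent
bookkeeping must give `μ` independent of `θ` (on paper `θ` enters only the constants
`e^{A₁²/(4θ)}`, `C_{k,θ}`); the qualitative `L > 0` surely is the tree's
`skeletonEventualSurjectivity`.
No instance / notation / option; no proof holes.  References: the tree files above;
[cite: CuneoEckmannHairerReyBellet2018, §3 eq. (3.4)]; (after EckmannPilletReyBellet1999fluct, §3);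
(after HairerMattingly2011spde, §6); (after Nualart2006, §2.3). [folklore]
-/

noncomputable section

namespace Summit.AtomisticToContinuum.FouriersLaw.Theorems.ExtensiveSnapshotIrreversibility.EnergyWindow

open MeasureTheory Filter Topology Set
open scoped ENNReal NNReal
open Literature.MathematicalPhysics.KineticTheory.HeatConduction Literature.Probability.Process

/-! ## 1. The statement (EBF) and the glue (EBF) ⇒ (MC∞) — PROVED -/

section Statements

/-- The body of **(EBF)** at fixed chain parameters: a sure observability floor
`L(s, z, wp) ≥ c_θ Θ_θ(z, wp)^{-μ}` for the limit Gram floor, `μ` independent of `θ`. [folklore] -/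
def EnergyBudgetGramFloorBody (ω₂ lam β γ : ℝ) : Prop :=
  ∀ T : ℝ, 0 < T → ∀ N : ℕ, 2 ≤ N →
    ∃ μ δ₀ : ℝ, 0 < μ ∧ 0 < δ₀ ∧ ∀ θ : ℝ, 0 < θ → ∃ c : ℝ, 0 < c ∧
      ∀ δ : ℝ, |δ| < δ₀ → ∀ s : ℝ, 1 / 2 ≤ s → s ≤ 1 →
        ∀ (z : PhaseSpace N) (wp : WienerPair),
          ENNReal.ofReal (c * energyBudget ω₂ lam β γ N (T + δ / 2) (T - δ / 2) θ z wp ^ (-μ)) ≤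
            skelGramLimitFloor ω₂ lam β γ N (T + δ / 2) (T - δ / 2) s z wp

/-- **(EBF) `EnergyBudgetGramFloor`** — for the chain driven at both ends: there is an exponent
`μ > 0` such that for EVERY `θ > 0` the limit Gram floor (the smallest eigenvalue of the
Malliavin/Gram matrix at time `s ∈ [½, 1]`) is bounded below ALONG EVERY PATH by
`c_θ · Θ_θ(z, wp)^{-μ}`, `Θ_θ = ∫₀¹ e^{θH(Φ_u)} du` the exponential energy budget of the path,
uniformly in `|δ| < δ₀`.  Measure-free; the quantitative form of the tree's
`costate_eq_zero_of_snd_left` (CEHR Prop. 4.1) — load-bearing input: `V'' ≥ 1` (tridiagonal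
costate recursion) + Landau–Kolmogorov interpolation on `[0, s]` with constants polynomial in
`Θ_θ` (the Grönwall and coefficient budgets are `≤ C_θ Θ_θ`).  Decided for the harmonic chain
(§2).  Why it might fail: the site-by-site exponent bookkeeping must give `μ` independent of
`θ` (it does on paper: `θ` enters only the constants `e^{A₁²/(4θ)}`, `C_{k,θ}`).
[NEW · measure-free leaf beneath (MC∞) · ATTACKABLE-L]
(after EckmannPilletReyBellet1999fluct, §3) (after HairerMattingly2011spde, §6) [route leaf · named hypothesis of this cell, NOT filed as a route item here] -/
def EnergyBudgetGramFloor : Prop :=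
  ∀ ω₂ lam β γ : ℝ, 0 < ω₂ → 0 < lam → 0 < β → 0 < γ → EnergyBudgetGramFloorBody ω₂ lam β γ

variable {ω₂ lam β γ : ℝ}

/-- **The glue (EBF) ⇒ (MC∞) at fixed parameters — PROVED** (with (EBM)): given `q, ε > 0` take
`r = max(μq, 1)`, `θ₁ = min(εq, 1/(4T))`, the floor at `θ = θ₁/r`; then pathwise
`L^{-q} ≤ c^{-q} Θ_θ^{μq} ≤ c^{-q} Θ_θ^r ≤ c^{-q} Θ_{θ₁}` (power means) and
`E Θ_{θ₁} ≤ e^{2γTθ₁} e^{θ₁H(z)} ≤ e^{2γTθ₁} e^{εqH(z)}`. [folklore] -/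
theorem skeletonGramLimitInverseMomentsBody_of_energyBudgetGramFloorBody (hω : 0 < ω₂)
    (hl : 0 ≤ lam) (hβ : 0 ≤ β) (hγ : 0 ≤ γ) (hF : EnergyBudgetGramFloorBody ω₂ lam β γ) :
    SkeletonGramLimitInverseMomentsBody ω₂ lam β γ := by
  intro T hT N hN q ε hq hε
  have hN0 : 0 < N := by omega
  obtain ⟨μ, δ₁, hμ, hδ₁, hfam⟩ := hF T hT N hN
  set r : ℝ := max (μ * q) 1 with hr
  have hr1 : 1 ≤ r := le_max_right _ _
  have hr0 : 0 < r := zero_lt_one.trans_le hr1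
  set θ₁ : ℝ := min (ε * q) (1 / (4 * T)) with hθ₁
  have hθ₁0 : 0 < θ₁ := lt_min (by positivity) (by positivity)
  have hθ₁ε : θ₁ ≤ ε * q := min_le_left _ _
  have hθ₁T : θ₁ ≤ 1 / (4 * T) := min_le_right _ _
  obtain ⟨c, hc, hfloor⟩ := hfam (θ₁ / r) (by positivity)
  set H := (pinnedChain ω₂ lam β γ).hamiltonian N with hH_def
  refine ⟨min δ₁ T, c⁻¹ * Real.exp (2 * γ * T * θ₁ / q), lt_min hδ₁ hT, by positivity,
    fun δ hδ s hs hs1 z => ?_⟩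
  have hδ₁' : |δ| < δ₁ := lt_of_lt_of_le hδ (min_le_left _ _)
  have hδT : |δ| < T := lt_of_lt_of_le hδ (min_le_right _ _)
  have hTL : 0 < T + δ / 2 := by linarith [(abs_lt.1 hδT).1]
  have hTR : 0 < T - δ / 2 := by linarith [(abs_lt.1 hδT).2]
  have hmpos : 0 < max (T + δ / 2) (T - δ / 2) := lt_max_of_lt_left hTL
  have hmax : max (T + δ / 2) (T - δ / 2) ≤ 2 * T :=
    max_le (by linarith [(abs_lt.1 hδT).2]) (by linarith [(abs_lt.1 hδT).1])
  have hθ' : θ₁ < 1 / max (T + δ / 2) (T - δ / 2) := by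
    rw [lt_div_iff₀ hmpos]
    calc θ₁ * max (T + δ / 2) (T - δ / 2) ≤ 1 / (4 * T) * (2 * T) :=
          mul_le_mul hθ₁T hmax hmpos.le (by positivity)
      _ = 1 / 2 := by field_simp; ring
      _ < 1 := by norm_num
  have hHz : 0 ≤ H z := pinnedChain_hamiltonian_nonneg hω.le hl hβ γ N z
  -- the moment bound at parameter `θ₁`
  have hM := lintegral_energyBudget_le hω hl hβ hγ hN0 hTL hTR hθ₁0 hθ' z
  -- pointwise: `L⁻¹^q ≤ c^{-q} Θ_{θ₁}`
  have hpt : ∀ wp, (skelGramLimitFloor ω₂ lam β γ N (T + δ / 2) (T - δ / 2) s z wp)⁻¹ ^ q ≤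
      ENNReal.ofReal (c⁻¹ ^ q) *
        ENNReal.ofReal (energyBudget ω₂ lam β γ N (T + δ / 2) (T - δ / 2) θ₁ z wp) := by
    intro wp
    set Θ := energyBudget ω₂ lam β γ N (T + δ / 2) (T - δ / 2) (θ₁ / r) z wp with hΘ
    have hΘ1 : 1 ≤ Θ := one_le_energyBudget hω hl hβ hγ (by positivity) z wp
    have hΘ0 : 0 < Θ := zero_lt_one.trans_le hΘ1
    have hx : 0 < c * Θ ^ (-μ) := mul_pos hc (Real.rpow_pos_of_pos hΘ0 _)
    have hL := hfloor δ hδ₁' s hs hs1 z wp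
    have h1 : (skelGramLimitFloor ω₂ lam β γ N (T + δ / 2) (T - δ / 2) s z wp)⁻¹ ≤
        ENNReal.ofReal ((c * Θ ^ (-μ))⁻¹) := by
      rw [ENNReal.ofReal_inv_of_pos hx]
      exact ENNReal.inv_le_inv.2 hL
    have h2 : (skelGramLimitFloor ω₂ lam β γ N (T + δ / 2) (T - δ / 2) s z wp)⁻¹ ^ q ≤
        ENNReal.ofReal ((c * Θ ^ (-μ))⁻¹ ^ q) := by
      rw [← ENNReal.ofReal_rpow_of_nonneg (inv_nonneg.2 hx.le) hq.le]
      exact ENNReal.rpow_le_rpow h1 hq.le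
    have h3a : (c * Θ ^ (-μ))⁻¹ = c⁻¹ * Θ ^ μ := by
      rw [mul_inv, Real.rpow_neg hΘ0.le, inv_inv]
    have h3 : ((c * Θ ^ (-μ))⁻¹) ^ q = c⁻¹ ^ q * Θ ^ (μ * q) := by
      rw [h3a, Real.mul_rpow (inv_nonneg.2 hc.le) (Real.rpow_nonneg hΘ0.le _),
        Real.rpow_mul hΘ0.le]
    have h4 : Θ ^ (μ * q) ≤ Θ ^ r := Real.rpow_le_rpow_of_exponent_le hΘ1 (le_max_left _ _)
    have h5 : Θ ^ r ≤ energyBudget ω₂ lam β γ N (T + δ / 2) (T - δ / 2) θ₁ z wp := by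
      have hpm := rpow_intervalIntegral_le
        (continuous_exp_mul_pathEnergy (T_L := T + δ / 2) (T_R := T - δ / 2) hω hl hβ hγ
          (θ₁ / r) z wp) (fun u => (Real.exp_pos _).le) hr1
      refine hpm.trans (le_of_eq ?_)
      unfold energyBudget
      refine intervalIntegral.integral_congr fun u _ => ?_
      rw [← Real.exp_mul, mul_right_comm, div_mul_cancel₀ _ hr0.ne']
    have h6 : c⁻¹ ^ q * Θ ^ (μ * q) ≤
        c⁻¹ ^ q * energyBudget ω₂ lam β γ N (T + δ / 2) (T - δ / 2) θ₁ z wp :=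
      mul_le_mul_of_nonneg_left (h4.trans h5) (Real.rpow_nonneg (inv_nonneg.2 hc.le) _)
    calc (skelGramLimitFloor ω₂ lam β γ N (T + δ / 2) (T - δ / 2) s z wp)⁻¹ ^ q
        ≤ ENNReal.ofReal ((c * Θ ^ (-μ))⁻¹ ^ q) := h2
      _ ≤ ENNReal.ofReal (c⁻¹ ^ q *
            energyBudget ω₂ lam β γ N (T + δ / 2) (T - δ / 2) θ₁ z wp) := by
          rw [h3]; exact ENNReal.ofReal_le_ofReal h6
      _ = _ := ENNReal.ofReal_mul (Real.rpow_nonneg (inv_nonneg.2 hc.le) _)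
  -- the constants
  have e1 : Real.exp (2 * γ * T * θ₁ / q) ^ q = Real.exp (2 * γ * T * θ₁) := by
    rw [← Real.exp_mul, div_mul_cancel₀ _ hq.ne']
  have e2 : Real.exp (ε * H z) ^ q = Real.exp (ε * q * H z) := by
    rw [← Real.exp_mul]
    congr 1
    ring
  have hreal : c⁻¹ ^ q * (Real.exp (θ₁ * γ * (T + δ / 2 + (T - δ / 2))) * Real.exp (θ₁ * H z)) ≤
      (c⁻¹ * Real.exp (2 * γ * T * θ₁ / q) * Real.exp (ε * H z)) ^ q := by
    rw [Real.mul_rpow (by positivity) (Real.exp_pos _).le,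
      Real.mul_rpow (by positivity) (Real.exp_pos _).le, e1, e2]
    have hs2 : Real.exp (θ₁ * γ * (T + δ / 2 + (T - δ / 2))) = Real.exp (2 * γ * T * θ₁) := by
      congr 1
      ring
    rw [hs2]
    have hexp : Real.exp (θ₁ * H z) ≤ Real.exp (ε * q * H z) :=
      Real.exp_le_exp.2 (mul_le_mul_of_nonneg_right hθ₁ε hHz)
    have hcq : 0 ≤ c⁻¹ ^ q := Real.rpow_nonneg (inv_nonneg.2 hc.le) _
    calc c⁻¹ ^ q * (Real.exp (2 * γ * T * θ₁) * Real.exp (θ₁ * H z))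
        ≤ c⁻¹ ^ q * (Real.exp (2 * γ * T * θ₁) * Real.exp (ε * q * H z)) :=
          mul_le_mul_of_nonneg_left (mul_le_mul_of_nonneg_left hexp (Real.exp_pos _).le) hcq
      _ = c⁻¹ ^ q * Real.exp (2 * γ * T * θ₁) * Real.exp (ε * q * H z) := (mul_assoc _ _ _).symm
  calc ∫⁻ wp, (skelGramLimitFloor ω₂ lam β γ N (T + δ / 2) (T - δ / 2) s z wp)⁻¹ ^ q ∂wienerPair
      ≤ ∫⁻ wp, ENNReal.ofReal (c⁻¹ ^ q) *
          ENNReal.ofReal (energyBudget ω₂ lam β γ N (T + δ / 2) (T - δ / 2) θ₁ z wp)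
            ∂wienerPair := lintegral_mono hpt
    _ = ENNReal.ofReal (c⁻¹ ^ q) *
          ∫⁻ wp, ENNReal.ofReal (energyBudget ω₂ lam β γ N (T + δ / 2) (T - δ / 2) θ₁ z wp)
            ∂wienerPair := lintegral_const_mul' _ _ ENNReal.ofReal_ne_top
    _ ≤ ENNReal.ofReal (c⁻¹ ^ q) * ENNReal.ofReal (Real.exp (θ₁ * γ * (T + δ / 2 + (T - δ / 2))) *
          Real.exp (θ₁ * H z)) := mul_le_mul' le_rfl hM
    _ = ENNReal.ofReal (c⁻¹ ^ q * (Real.exp (θ₁ * γ * (T + δ / 2 + (T - δ / 2))) *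
          Real.exp (θ₁ * H z))) :=
        (ENNReal.ofReal_mul (Real.rpow_nonneg (inv_nonneg.2 hc.le) _)).symm
    _ ≤ ENNReal.ofReal ((c⁻¹ * Real.exp (2 * γ * T * θ₁ / q) * Real.exp (ε * H z)) ^ q) :=
        ENNReal.ofReal_le_ofReal hreal

/-- **(EBF) ⇒ (MC∞) — PROVED** (the measure half (EBM) is a theorem). [folklore] -/
theorem skeletonGramLimitInverseMoments_of_energyBudgetGramFloor (hF : EnergyBudgetGramFloor) :
    SkeletonGramLimitInverseMoments :=
  fun ω₂ lam β γ hω hl hβ hγ =>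
    skeletonGramLimitInverseMomentsBody_of_energyBudgetGramFloorBody hω hl.le hβ.le hγ.le
      (hF ω₂ lam β γ hω hl hβ hγ)

end Statements

/-! ## 2. Calibration: (EBF) is decided for the harmonic chain -/

section Harmonic

variable {ω₂ γ : ℝ} (hω : 0 < ω₂) (hγ : 0 < γ)
include hω hγ

/-- **(EBF) holds for the harmonic chain** (`lam = β = 0`, every `N ≥ 2`, `μ = 1`, `c_θ = η`):
part `…SkeletonGramFloor` gives a CONSTANT frame bound `η |a|² ≤ aᵀΓ_m a` for `m ≥ m₁`,
`|δ| < T`, `s ∈ [½, 1]`, so `L ≥ η ≥ η Θ_θ^{-1}` (`Θ_θ ≥ 1`). [folklore] -/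
theorem harmonic_energyBudgetGramFloorBody : EnergyBudgetGramFloorBody ω₂ 0 0 γ := by
  intro T hT N hN
  have hN0 : 0 < N := by omega
  obtain ⟨η, hη, m₁, hm₁⟩ := harmonic_gramFloor hω hγ N hN hT
  refine ⟨1, T, one_pos, hT, fun θ hθ => ⟨η, hη, fun δ hδ s hs hs1 z wp => ?_⟩⟩
  have hΘ1 : 1 ≤ energyBudget ω₂ 0 0 γ N (T + δ / 2) (T - δ / 2) θ z wp :=
    one_le_energyBudget hω le_rfl le_rfl hγ.le hθ.le z wp
  have hle : η * energyBudget ω₂ 0 0 γ N (T + δ / 2) (T - δ / 2) θ z wp ^ (-(1 : ℝ)) ≤ η := by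
    rw [Real.rpow_neg_one]
    exact mul_le_of_le_one_right hη.le (inv_le_one_of_one_le₀ hΘ1)
  calc ENNReal.ofReal (η * energyBudget ω₂ 0 0 γ N (T + δ / 2) (T - δ / 2) θ z wp ^ (-(1 : ℝ)))
      ≤ ENNReal.ofReal η := ENNReal.ofReal_le_ofReal hle
    _ ≤ ENNReal.ofReal (skelGramFloor ω₂ 0 0 γ N (T + δ / 2) (T - δ / 2) s m₁ z wp) :=
        ENNReal.ofReal_le_ofReal
          (le_skelGramFloor hN0 m₁ z wp (hm₁ m₁ le_rfl δ hδ s hs hs1 z wp))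
    _ ≤ skelGramLimitFloor ω₂ 0 0 γ N (T + δ / 2) (T - δ / 2) s z wp :=
        ofReal_skelGramFloor_le_limitFloor m₁ z wp

end Harmonic

end Summit.AtomisticToContinuum.FouriersLaw.Theorems.ExtensiveSnapshotIrreversibility.EnergyWindow
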